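import Mathlib
import HarnessLib
import Summits.HubbardSuperconductivity.HubbardSuperconductivity.Theorems.KLProgrammeKLRegimeTwoVolumeStepMajorant
import Summits.HubbardSuperconductivity.HubbardSuperconductivity.Theorems.KLProgrammeKLRegimeTwoVolumeGridBlockStepResponse
import Summits.HubbardSuperconductivity.HubbardSuperconductivity.Theorems.KLProgrammeKLRegimeTwoVolumeGluedProfiles
import Summits.HubbardSuperconductivity.HubbardSuperconductivity.Theorems.KLProgrammeKLRegimeTwoVolumeProfileBridge
import Summits.HubbardSuperconductivity.HubbardSuperconductivity.Theorems.KLProgrammeKLRegimeEngineScaleZeroE4GridVertex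
import Summits.HubbardSuperconductivity.HubbardSuperconductivity.Theorems.KLProgrammeKLRegimeTwoVolumeGridCounterGluingWt

/-!
# Route `KLProgramme` — crux K3, VL child `KLRegimeVolumeLimitV17F2` (stmt-HubbardSuperconductivity-20440), (vi) blueprint v4 M4a:
# THE SCALE-`0` TWO-VOLUME STEP ON THE GRID AT TWO TOP FRAMES (common covariance frame, counterterm vertices `𝒩_K`, `𝒩_{K″}`)
# (cell gate-hubbard-kl, seat hubbard-kl-k3c4-p1 g11; `--supports` stmt-…-20440)

The generic two-volume STEP in linear form (`TwoVolumeDefect.sum_norm_kernel_twoVolume_step_le_linear`, p555515) instantiated on the grid legs of two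
nested tori `L″ = b·L` for the scale-`0` (ultraviolet) step of the own-top-frame induction: covariances = the grid pull-backs `S_Vᵀ·normalCovariance p_V·S_V`
of ONE sampled symbol `F` (the UV covariance at the COMMON frame `K`; the fine volume's own frame `K″` enters the covariance through the one-volume
frame-response bracket, `…TwoVolumeFrameResponseTower`, not here), inputs `V = V_N + 𝒩_{K,L,N}` (coarse) and `W′ = V_N + 𝒩_{K″,L″,N}` (fine).  What is
MODEL-specific and discharged here: the block structure, the pieces `Ccop/Df/Dn`, (P) periodisation and antisymmetry of the pull-backs
(`…TwoVolumeGridPeriodisationLegs`), (G1)/(G2) and the pin geometry (`…TwoVolumeTorusBlocks`), the near entries (`norm_near_le_of_sectional`), the Gram families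
of the defects, parity / constant parts, the glued input's weighted profile (`sum_norm_kernel_gridVertex_mul_wt_le` ∘ `…GluedProfiles`), and the INPUT
DEFECT `W′ − Glue V = 𝒩_{K″} − Glue 𝒩_K` — everywhere in the weight `1 + tnorm(residues)` (`sum_wt_norm_kernel_counterGlueDefect_le`, p578122) and at
`R`-deep pins the frame mismatch only (`sum_norm_kernel_counterGlueDefect_le_of_deep`, p577438).  What stays a hypothesis (ONE-volume analytic data, as in
k3c5-p2's `…GridBlockStepResponseMaj`): tails `T`, sectional sums `Te`, sup/rows/first moments, Gram constants, the coarse output profile `Nw` and unit, the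
weighted rows `αw` of `C_{L″}`, the smallness conditions, and MAJORANT budgets `E, ND, NV` of the three model profiles (free outputs, `…_le_…` hypotheses).

* **`hubbardGrid_sum_norm_kernel_twoVolume_stepZero_le`**.  Sorry-free; no definition.
References: BGM 2003 §1.2 (2.10); BGM 2006 §2; Salmhofer 1999 §4.2.4, §4.3 (2.102)–(2.106).
-/

noncomputable section

namespace Summit.HubbardSuperconductivity.HubbardSuperconductivity.Theorems.TwoVolumeDefect

set_option linter.dupNamespace false -- summit = problem name (single-conjunct summit), D-0017

open Finset Literature.MathematicalPhysics.QuantumLattice GrassmannAlgebra Literature.Probability.LatticeModels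
  Literature.Probability.LatticeModels.BattleFederbush
open Summit.HubbardSuperconductivity.HubbardSuperconductivity.Theorems.KLRegimeSplit
open Summit.HubbardSuperconductivity.HubbardSuperconductivity.Theorems.TwoPointAssembly
open Summit.HubbardSuperconductivity.HubbardSuperconductivity.Theorems.EngineV8

/-- **THE SCALE-`0` TWO-VOLUME STEP ON THE GRID AT TWO TOP FRAMES** (common covariance frame; see the module docstring for the roles of the data).
[folklore; BGM 2006 §2; Salmhofer 1999 (2.102)–(2.106)] -/
theorem hubbardGrid_sum_norm_kernel_twoVolume_stepZero_le {b L Lf M N : ℕ} [NeZero Lf] [NeZero L] [NeZero N] [LinearOrder (GridLeg (GridPoint Lf N))]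
    (hLf : Lf = b * L) {β : ℝ} (hβ : β ≠ 0)
    (F : MatsubaraIdx M → Fin 2 → (Fin 2 → ℝ) → ℂ) (pL : FreqMomentum L M × Fin 2 → ℂ) (pLf : FreqMomentum Lf M × Fin 2 → ℂ)
    (hpL : ∀ (k : FreqMomentum L M) (σ : Fin 2), pL (k, σ) = ((β * (L : ℝ) ^ 2 : ℝ) : ℂ) * F k.1 σ (latticeMomentum L k.2))
    (hpLf : ∀ (k : FreqMomentum Lf M) (σ : Fin 2), pLf (k, σ) = ((β * (Lf : ℝ) ^ 2 : ℝ) : ℂ) * F k.1 σ (latticeMomentum Lf k.2))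
    (CL : Matrix (GridLeg (GridPoint L N)) (GridLeg (GridPoint L N)) ℂ)
    (hCL : CL = (hubbardGridSub L M β N).transpose * normalCovariance L M pL * hubbardGridSub L M β N)
    (CLf : Matrix (GridLeg (GridPoint Lf N)) (GridLeg (GridPoint Lf N)) ℂ)
    (hCLf : CLf = (hubbardGridSub Lf M β N).transpose * normalCovariance Lf M pLf * hubbardGridSub Lf M β N)
    -- the two top frames: `K` (coarse volume, also the covariance frame) and `K″` (fine volume), of degree `< R`
    (U : ℝ) (K K'' : TrigPolyC4v)
    -- depth of the zone, extra depth of the pin, the pin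
    (R R' : ℕ) (hRK : K.degree < R) (hRK'' : K''.degree < R)
    (w : GridLeg (GridPoint Lf N)) (hw : ∀ j, R + R' ≤ (w.1.1.2 j).val % L ∧ (w.1.1.2 j).val % L + (R + R') < L)
    -- decay numbers of the two covariances
    {T : ℝ} (hT0 : 0 < T) (hT : ∀ X', ∑ Y' ∈ univ.filter (fun Y' : GridLeg (GridPoint Lf N) => R < Torus.tnorm (X'.1.1.2 - Y'.1.1.2)), ‖CLf X' Y'‖ ≤ T)
    {Te : ℝ} (hsec : ∀ (X' : GridLeg (GridPoint Lf N)) (t : Fin N) (σ c : Fin 2),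
      ∑ y ∈ univ.filter (fun y : TorusSite 2 Lf => R < Torus.tnorm (X'.1.1.2 - y)), ‖CLf X' (((t, y), σ), c)‖ ≤ Te)
    {s s' : ℝ} (hs0 : 0 ≤ s) (hs'0 : 0 ≤ s') (hs : ∀ X Y, ‖CL X Y‖ ≤ s) (hs' : ∀ X' Y', ‖CLf X' Y'‖ ≤ s')
    {α α' : ℝ} (hαα : 0 < α' + α) (hrow : ∀ X, ∑ Y, ‖CL X Y‖ ≤ α) (hrow' : ∀ X', ∑ Y', ‖CLf X' Y'‖ ≤ α')
    {m₁ m₁' : ℝ} (hm0 : 0 ≤ m₁) (hm0' : 0 ≤ m₁')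
    (hm1 : ∀ X, ∑ Y, ‖CL X Y‖ * (Torus.tnorm (X.1.1.2 - Y.1.1.2) : ℝ) ≤ m₁)
    (hm1' : ∀ X', ∑ Y', ‖CLf X' Y'‖ *
      (Torus.tnorm ((fun i => (((X'.1.1.2 i).val : ℕ) : ZMod L)) - fun i => (((Y'.1.1.2 i).val : ℕ) : ZMod L)) : ℝ) ≤ m₁')
    -- replica-Gram-boundedness of the two covariances
    {κ κ' : ℝ} (hκ : 0 < κ) (hκ' : 0 < κ') (hGB : IsGramBoundedR CL κ) (hGB' : IsGramBoundedR CLf κ')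
    -- the coarse partition function and OUTPUT weighted profile, and the two smallness conditions of the covariance bracket
    (hZ : IsUnit (effPartitionFn ℂ CL (hubbardGridInteraction L N β U + hubbardGridCounterQuadratic L N β K)))
    (Nw : ℕ → ℝ) (hNw0 : ∀ m, 0 ≤ Nw m)
    (hNw : ∀ (m' : ℕ) (j : Fin (2 * m')) (x : GridLeg (GridPoint L N)),
      ∑ Y ∈ univ.filter (fun Y : Fin (2 * m') → GridLeg (GridPoint L N) => Y j = x),
        ‖kernel ℂ (effAction ℂ CL (hubbardGridInteraction L N β U + hubbardGridCounterQuadratic L N β K)) (2 * m') Y‖ *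
          (1 + labelDiam (fun Y₁ Y₂ : GridLeg (GridPoint L N) => (Torus.tnorm (Y₁.1.1.2 - Y₂.1.1.2) : ℝ)) (univ.image Y)) ≤ Nw m')
    {ρf : ℝ} (hρf : 0 < ρf)
    (hθw : Real.exp 1 * (α' + α + (m₁' + m₁)) * normV (GridLeg (GridPoint Lf N)) (κ' + κ) ρf Nw / (κ' + κ) ^ 2 < 1)
    {ρ₂ : ℝ} (hρ₂ : 0 < ρ₂)
    (hθ₂ : Real.exp 1 * (α' + α + (m₁' + m₁)) * normV (GridLeg (GridPoint Lf N)) (κ' + κ + (κ' + κ + (κ' + κ))) ρ₂ Nw /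
      (κ' + κ + (κ' + κ + (κ' + κ))) ^ 2 < 1)
    -- the INTERACTION bracket: weighted rows of the fine covariance in the block-periodic residue distance, majorant budgets of the three model profiles
    {αw : ℝ} (hαw : 0 < αw)
    (hroww : ∀ X', ∑ Y', ‖CLf X' Y'‖ *
      (1 + (Torus.tnorm ((fun i => (((X'.1.1.2 i).val : ℕ) : ZMod L)) - fun i => (((Y'.1.1.2 i).val : ℕ) : ZMod L)) : ℝ)) ≤ αw)
    (hcolw : ∀ Y', ∑ X', ‖CLf X' Y'‖ *
      (1 + (Torus.tnorm ((fun i => (((X'.1.1.2 i).val : ℕ) : ZMod L)) - fun i => (((Y'.1.1.2 i).val : ℕ) : ZMod L)) : ℝ)) ≤ αw)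
    (NV ND E : ℕ → ℝ) (hNV0 : ∀ m', 0 ≤ NV m') (hND0 : ∀ m', 0 ≤ ND m') (hE0 : ∀ m', 0 ≤ E m')
    (hNV : ∀ m', (if m' = 1 then |β| / N * ∑ z : TorusSite 2 L, ‖framePosKernel L K z‖ * (1 + torusSiteDist z 0)
      else if m' = 2 then |U| * |β| / N else 0 : ℝ) ≤ NV m')
    (hND : (1 + (R : ℝ)) * (|β| / N * (K''.coeffNorm 0 + K.coeffNorm 0)) ≤ ND 1)
    (hE : |β| / N * (fsub K'' K).coeffNorm 0 ≤ E 1)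
    {ρ' : ℝ} (hρ' : 0 < ρ') {νEbar : ℝ} (hνE : normV (GridLeg (GridPoint Lf N)) κ' ρ' E ≤ νEbar)
    (hbar : Real.exp 1 * αw * (normV (GridLeg (GridPoint Lf N)) κ' ρ' (fun m' => NV m' + ND m') + νEbar) / κ' ^ 2 < 1)
    (hθ₂' : Real.exp 1 * αw * (normV (GridLeg (GridPoint Lf N)) κ' ρ' NV + normV (GridLeg (GridPoint Lf N)) κ' ρ' ND) / κ' ^ 2 < 1)
    (n : ℕ) (p : Fin (n + 1)) :
    ∑ X ∈ univ.filter (fun X : Fin (n + 1) → GridLeg (GridPoint Lf N) => X p = w),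
        ‖kernel ℂ (effAction ℂ CLf (hubbardGridInteraction Lf N β U + hubbardGridCounterQuadratic Lf N β K'')) (n + 1) X -
          (if ∀ i j, ((X i).1.1.2 j).val / L = ((X p).1.1.2 j).val / L then
            kernel ℂ (effAction ℂ CL (hubbardGridInteraction L N β U + hubbardGridCounterQuadratic L N β K)) (n + 1)
              (fun i => ((((X i).1.1.1, fun j => ((((X i).1.1.2 j).val : ℕ) : ZMod L)), (X i).1.2), (X i).2))
          else 0)‖ ≤
            (ρ'⁻¹ ^ (n + 1) * Real.exp 1 / (1 - Real.exp 1 * αw * (normV (GridLeg (GridPoint Lf N)) κ' ρ' (fun m' => NV m' + ND m') + νEbar) / κ' ^ 2) ^ 2) * normV (GridLeg (GridPoint Lf N)) κ' ρ' E +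
        (ρ'⁻¹ ^ (n + 1) * (Real.exp 1 * normV (GridLeg (GridPoint Lf N)) κ' ρ' ND) / (1 - Real.exp 1 * αw * (normV (GridLeg (GridPoint Lf N)) κ' ρ' NV + normV (GridLeg (GridPoint Lf N)) κ' ρ' ND) / κ' ^ 2) ^ 2) * (1 + ((R' : ℝ) + 1))⁻¹ +
        ((((n + 1 + 1) * (n + 1 + 2) : ℕ) : ℝ) / 2 *
            (ρ₂⁻¹ ^ (n + 3) * (Real.exp 1 * normV (GridLeg (GridPoint Lf N)) (κ' + κ + (κ' + κ + (κ' + κ))) ρ₂ Nw) / (1 - Real.exp 1 * (α' + α + (m₁' + m₁)) * normV (GridLeg (GridPoint Lf N)) (κ' + κ + (κ' + κ + (κ' + κ))) ρ₂ Nw / (κ' + κ + (κ' + κ + (κ' + κ))) ^ 2))) * Te +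
        (‖(2 : ℂ)⁻¹‖ * ∑ a ∈ range (n + 2), ∑ b ∈ range (n + 2),
            (if a + b = n + 1 then (((a + 1) * (b + 1) : ℕ) : ℝ) *
              (4 * (ρ₂⁻¹ ^ (a + 1) * (Real.exp 1 * normV (GridLeg (GridPoint Lf N)) (κ' + κ + (κ' + κ + (κ' + κ))) ρ₂ Nw) / (1 - Real.exp 1 * (α' + α + (m₁' + m₁)) * normV (GridLeg (GridPoint Lf N)) (κ' + κ + (κ' + κ + (κ' + κ))) ρ₂ Nw / (κ' + κ + (κ' + κ + (κ' + κ))) ^ 2)) *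
                (ρ₂⁻¹ ^ (b + 1) * (Real.exp 1 * normV (GridLeg (GridPoint Lf N)) (κ' + κ + (κ' + κ + (κ' + κ))) ρ₂ Nw) / (1 - Real.exp 1 * (α' + α + (m₁' + m₁)) * normV (GridLeg (GridPoint Lf N)) (κ' + κ + (κ' + κ + (κ' + κ))) ρ₂ Nw / (κ' + κ + (κ' + κ + (κ' + κ))) ^ 2))) else 0)) * T +
        ((((n + 1 + 1) * (n + 1 + 2) : ℕ) : ℝ) / 2 * (s' + s) *
              (ρf⁻¹ ^ (n + 3) * (Real.exp 1 * normV (GridLeg (GridPoint Lf N)) (κ' + κ) ρf Nw) / (1 - Real.exp 1 * (α' + α + (m₁' + m₁)) * normV (GridLeg (GridPoint Lf N)) (κ' + κ) ρf Nw / (κ' + κ) ^ 2)) +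
            ‖(2 : ℂ)⁻¹‖ * ∑ a ∈ range (n + 2), ∑ b ∈ range (n + 2),
              (if a + b = n + 1 then (((a + 1) * (b + 1) : ℕ) : ℝ) *
                (2 * (α' + α) * (ρf⁻¹ ^ (a + 1) * (Real.exp 1 * normV (GridLeg (GridPoint Lf N)) (κ' + κ) ρf Nw) / (1 - Real.exp 1 * (α' + α + (m₁' + m₁)) * normV (GridLeg (GridPoint Lf N)) (κ' + κ) ρf Nw / (κ' + κ) ^ 2)) *
                  (ρf⁻¹ ^ (b + 1) * (Real.exp 1 * normV (GridLeg (GridPoint Lf N)) (κ' + κ) ρf Nw) / (1 - Real.exp 1 * (α' + α + (m₁' + m₁)) * normV (GridLeg (GridPoint Lf N)) (κ' + κ) ρf Nw / (κ' + κ) ^ 2))) else 0)) * ((R' : ℝ) + 1)⁻¹ := by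
  classical
  -- the block structure of the grid legs
  obtain ⟨e, he1, he2⟩ := exists_gridLegBlockEquiv hLf N
  -- a block embedding per box
  set Fe : (Fin 2 → Fin b) → (GridLeg (GridPoint L N) → ℂ) →ₗ[ℂ] (GridLeg (GridPoint Lf N) → ℂ) := fun β' =>
    LinearMap.pi (fun X' : GridLeg (GridPoint Lf N) => if (e X').1 = β' then
      (LinearMap.proj (e X').2 : (GridLeg (GridPoint L N) → ℂ) →ₗ[ℂ] ℂ) else 0) with hFe_def
  have hFe : ∀ β' v X', Fe β' v X' = if (e X').1 = β' then v (e X').2 else 0 := fun β' v X' => blockEmb_pi_apply ℂ e β' v X'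
  -- names
  set V : GrassmannAlgebra ℂ (GridLeg (GridPoint L N)) := hubbardGridInteraction L N β U + hubbardGridCounterQuadratic L N β K with hV
  set W' : GrassmannAlgebra ℂ (GridLeg (GridPoint Lf N)) := hubbardGridInteraction Lf N β U + hubbardGridCounterQuadratic Lf N β K'' with hW'
  -- the pieces
  set Ccop : Matrix (GridLeg (GridPoint Lf N)) (GridLeg (GridPoint Lf N)) ℂ :=
    Matrix.of fun X' Y' => if (e X').1 = (e Y').1 then CL (e X').2 (e Y').2 else 0 with hCcop_def
  set Zs : Set (GridLeg (GridPoint Lf N)) := {X' | ¬ ∀ j, R ≤ (X'.1.1.2 j).val % L ∧ (X'.1.1.2 j).val % L + R < L} with hZs_def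
  set Df : Matrix (GridLeg (GridPoint Lf N)) (GridLeg (GridPoint Lf N)) ℂ :=
    Matrix.of fun X' Y' => if X' ∈ Zs ∧ Y' ∈ Zs then CLf X' Y' - Ccop X' Y' else 0 with hDf_def
  set Dn : Matrix (GridLeg (GridPoint Lf N)) (GridLeg (GridPoint Lf N)) ℂ :=
    Matrix.of fun X' Y' => if X' ∈ Zs ∧ Y' ∈ Zs then 0 else CLf X' Y' - Ccop X' Y' with hDn_def
  have hCcop : ∀ X' Y', Ccop X' Y' = if (e X').1 = (e Y').1 then CL (e X').2 (e Y').2 else 0 := fun X' Y' => rfl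
  have hDf : ∀ X' Y', Df X' Y' = if X' ∈ Zs ∧ Y' ∈ Zs then CLf X' Y' - Ccop X' Y' else 0 := fun X' Y' => rfl
  have hDn : ∀ X' Y', Dn X' Y' = if X' ∈ Zs ∧ Y' ∈ Zs then 0 else CLf X' Y' - Ccop X' Y' := fun X' Y' => rfl
  -- (P) periodisation, antisymmetry of the grid pull-backs
  have hP : ∀ (X' : GridLeg (GridPoint Lf N)) (Y : GridLeg (GridPoint L N)),
      ∑ Y'' ∈ univ.filter (fun Y'' : GridLeg (GridPoint Lf N) => (e Y'').2 = Y), CLf X' Y'' = CL (e X').2 Y := by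
    intro X' Y
    rw [hCL, hCLf]
    exact hubbardGridSub_pullback_periodise_leg hLf hβ N F pL pLf hpL hpLf e he2 X' Y
  have hCt : ∀ X Y, CL Y X = -CL X Y := fun X Y => by rw [hCL]; exact hubbardGridSub_pullback_swap β N pL X Y
  have hC't : ∀ X' Y', CLf Y' X' = -CLf X' Y' := fun X' Y' => by rw [hCLf]; exact hubbardGridSub_pullback_swap β N pLf X' Y'
  -- the e-free reading of the glued kernel
  have hsub : ∀ X : Fin (n + 1) → GridLeg (GridPoint Lf N),
      kernel ℂ (∑ β', ExteriorAlgebra.map (Fe β') (effAction ℂ CL V)) (n + 1) X =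
        if ∀ i j, ((X i).1.1.2 j).val / L = ((X p).1.1.2 j).val / L then
          kernel ℂ (effAction ℂ CL V) (n + 1) (fun i => ((((X i).1.1.1, fun j => ((((X i).1.1.2 j).val : ℕ) : ZMod L)), (X i).1.2), (X i).2))
        else 0 := by
    intro X
    rw [kernel_copies_sum e Fe hFe _ p X]
    have hiff : (∀ i, (e (X i)).1 = (e (X p)).1) ↔ ∀ i j, ((X i).1.1.2 j).val / L = ((X p).1.1.2 j).val / L := by
      refine ⟨fun h i j => ?_, fun h i => funext fun j => Fin.ext ?_⟩
      · rw [← he1, ← he1, h i]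
      · rw [he1, he1]; exact h i j
    have hproj : (fun i => (e (X i)).2) = fun i => ((((X i).1.1.1, fun j => ((((X i).1.1.2 j).val : ℕ) : ZMod L)), (X i).1.2), (X i).2) :=
      funext fun i => he2 (X i)
    by_cases h : ∀ i j, ((X i).1.1.2 j).val / L = ((X p).1.1.2 j).val / L
    · rw [if_pos (hiff.2 h), if_pos h, hproj]
    · rw [if_neg (fun h' => h (hiff.1 h')), if_neg h]
  simp_rw [← hsub]
  -- geometry: (G1), (G2), the pin is far from the zone in the coarse distance; non-deep labels are far from the pin in the residue distance
  have hG1 : ∀ X' Y', (e X').1 ≠ (e Y').1 → ¬ (X' ∈ Zs ∧ Y' ∈ Zs) → R < Torus.tnorm (X'.1.1.2 - Y'.1.1.2) :=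
    fun X' Y' hne hnz => far_of_block_ne hLf e he1 hne hnz
  have hG2 : ∀ X' Y' Y'', (e X').1 = (e Y').1 → (e Y'').2 = (e Y').2 → Y'' ≠ Y' → ¬ (X' ∈ Zs ∧ Y' ∈ Zs) →
      R < Torus.tnorm (X'.1.1.2 - Y''.1.1.2) :=
    fun X' Y' Y'' hb hf hn hnz => far_of_fibre_ne hLf e he1 he2 hb hf hn hnz
  set dc : GridLeg (GridPoint L N) → GridLeg (GridPoint L N) → ℝ := fun Y₁ Y₂ => (Torus.tnorm (Y₁.1.1.2 - Y₂.1.1.2) : ℝ) with hdc_def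
  have hdc : IsLabelDist dc := isLabelDist_tnorm_site
  set d' : GridLeg (GridPoint Lf N) → GridLeg (GridPoint Lf N) → ℝ := fun X' Y' => dc (e X').2 (e Y').2 with hd'_def
  have hd' : IsLabelDist d' := hdc.comap (fun X' => (e X').2)
  have hd'red : ∀ X' Y' : GridLeg (GridPoint Lf N), d' X' Y' =
      (Torus.tnorm ((fun i => (((X'.1.1.2 i).val : ℕ) : ZMod L)) - fun i => (((Y'.1.1.2 i).val : ℕ) : ZMod L)) : ℝ) := by
    intro X' Y'; simp only [hd'_def, hdc_def]; rw [he2, he2]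
  have hdR : ∀ X, X ∈ Zs → (R' : ℝ) + 1 ≤ dc (e X).2 (e w).2 := by
    intro X hX
    have h := tnorm_red_sub_gt_of_not_deep_of_deep (L := L) hX hw
    simp only [hdc_def]
    rw [he2, he2]
    exact_mod_cast Nat.succ_le_of_lt h
  have hwd : ∀ z : GridLeg (GridPoint Lf N), ¬ (∀ j, R ≤ (z.1.1.2 j).val % L ∧ (z.1.1.2 j).val % L + R < L) → (R' : ℝ) + 1 ≤ d' z w := by
    intro z hz
    have h := tnorm_red_sub_gt_of_not_deep_of_deep (L := L) hz hw
    rw [hd'red]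
    exact_mod_cast Nat.succ_le_of_lt h
  -- the first moment of the fine covariance in the pulled-back coarse distance
  have hm1'' : ∀ X', ∑ Y', ‖CLf X' Y'‖ * dc (e X').2 (e Y').2 ≤ m₁' := by
    intro X'
    refine le_trans (le_of_eq (sum_congr rfl fun Y' _ => ?_)) (hm1' X')
    simp only [hdc_def]
    rw [he2, he2]
  -- the weight `φ(s) = 1 + s`
  set phi : ℝ → ℝ := fun t => 1 + t with hphi
  have hphi1 : ∀ t, 0 ≤ t → 1 ≤ phi t := fun t ht => by simp only [hphi]; linarith
  have hphimono : ∀ s t, 0 ≤ s → s ≤ t → phi s ≤ phi t := fun s t _ hst => by simp only [hphi]; linarith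
  have hphisub : ∀ s t, 0 ≤ s → 0 ≤ t → phi (s + t) ≤ phi s * phi t := fun s t hs ht => by simp only [hphi]; nlinarith
  have hpairw : ∀ X' Y' : GridLeg (GridPoint Lf N), diamWeight phi d' {X', Y'} =
      1 + (Torus.tnorm ((fun i => (((X'.1.1.2 i).val : ℕ) : ZMod L)) - fun i => (((Y'.1.1.2 i).val : ℕ) : ZMod L)) : ℝ) := by
    intro X' Y'; rw [diamWeight_pair hd', ← hd'red]
  have hroww' : ∀ X', ∑ Y', ‖CLf X' Y'‖ * diamWeight phi d' {X', Y'} ≤ αw := fun X' => by simp only [hpairw]; exact hroww X'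
  have hcolw' : ∀ Y', ∑ X', ‖CLf X' Y'‖ * diamWeight phi d' {X', Y'} ≤ αw := fun Y' => by simp only [hpairw]; exact hcolw Y'
  -- parity / constant part of the two inputs
  have hVe : V ∈ evenOdd ℂ 0 :=
    (mem_evenPart_iff).1 (add_mem (hubbardGridInteraction_mem_evenPart β U) (hubbardGridCounterQuadratic_mem_evenPart β K))
  have hV0 : constPart ℂ V = 0 := by
    rw [hV, map_add, constPart_hubbardGridInteraction, constPart_hubbardGridCounterQuadratic, add_zero]
  have hW'e : W' ∈ evenPart ℂ (GridLeg (GridPoint Lf N)) :=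
    add_mem (hubbardGridInteraction_mem_evenPart β U) (hubbardGridCounterQuadratic_mem_evenPart β K'')
  have hW'0 : constPart ℂ W' = 0 := by
    rw [hW', map_add, constPart_hubbardGridInteraction, constPart_hubbardGridCounterQuadratic, add_zero]
  -- the Gram PROPERTIES of the two defects from those of `C_L`, `C_{Lf}`
  have hGBcop : IsGramBoundedR Ccop κ := isGramBoundedR_blockCopies hGB (fun X' => (e X').1) (fun X' => (e X').2) Ccop hCcop
  have hGBsub : IsGramBoundedR (CLf - Ccop) (κ' + κ) := hGB'.sub hGBcop hκ'.le
  have hGBf1 : IsGramBoundedR Df (κ' + κ) :=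
    isGramBoundedR_mask hGBsub Zs Df (fun X' Y' => by rw [hDf, Matrix.sub_apply])
  have hGBf : ∀ t ∈ Set.Icc (0 : ℝ) 1, IsGramBoundedR (t • Df) (κ' + κ) := fun t ht => isGramBoundedR_real_smul hGBf1 ht.1 ht.2
  have hDn_eq : Dn = (CLf - Ccop) - Df := by
    ext X' Y'
    rw [hDn, Matrix.sub_apply, Matrix.sub_apply, hDf]
    split_ifs <;> simp
  have hGBn : IsGramBoundedR Dn (κ' + κ + (κ' + κ)) := by
    rw [hDn_eq]; exact hGBsub.sub hGBf1 (add_nonneg hκ'.le hκ.le)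
  have hGB2 : ∀ t ∈ Set.Icc (0 : ℝ) 1, IsGramBoundedR (Df + t • Dn) (κ' + κ + (κ' + κ + (κ' + κ))) := fun t ht =>
    hGBf1.add (isGramBoundedR_real_smul hGBn ht.1 ht.2) (add_nonneg hκ'.le hκ.le)
  -- the INPUT defect `W′ − Glue V = 𝒩_{K″} − Glue 𝒩_K`
  have hdef : W' - ∑ β', ExteriorAlgebra.map (Fe β') V =
      hubbardGridCounterQuadratic Lf N β K'' - ∑ β', ExteriorAlgebra.map (Fe β') (hubbardGridCounterQuadratic L N β K) := by
    rw [hW', hV]; exact gridAction_sub_glue_eq e Fe hFe he1 he2 β U K K''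
  have hβN : 0 ≤ |β| / N * (K''.coeffNorm 0 + K.coeffNorm 0) := by
    have := TrigPolyC4v.coeffNorm_nonneg 0 K''; have := TrigPolyC4v.coeffNorm_nonneg 0 K; positivity
  -- glued input: weighted profile
  have hNVp : ∀ m' (j : Fin (2 * m')) (x : GridLeg (GridPoint Lf N)),
      ∑ Y ∈ univ.filter (fun Y : Fin (2 * m') → GridLeg (GridPoint Lf N) => Y j = x),
        ‖kernel ℂ (∑ β', ExteriorAlgebra.map (Fe β') V) (2 * m') Y‖ * diamWeight phi d' (univ.image Y) ≤ NV m' := by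
    intro m' j x
    refine (sum_pinned_wt_norm_kernel_glue_le e Fe hFe dc d' (fun β' x y => by simp only [hd'_def, Equiv.apply_symm_apply]) phi V j
      (N := NV m') (fun y => ?_) x)
    refine le_trans (le_trans (sum_le_sum fun Y _ => ?_) (sum_norm_kernel_gridVertex_mul_wt_le (L := L) (Ng := N) β U le_rfl K m' j y)) (hNV m')
    have hw1 : diamWeight phi dc (univ.image Y) = 1 + labelDiam dc (univ.image Y) := rfl
    rw [hw1]
    exact mul_le_mul_of_nonneg_left (one_add_labelDiam_tnorm_le_gridLabelWt le_rfl _) (norm_nonneg _)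
  -- input defect: weighted profile everywhere
  have hNDp : ∀ m' (j : Fin (2 * m')) (x : GridLeg (GridPoint Lf N)),
      ∑ Y ∈ univ.filter (fun Y : Fin (2 * m') → GridLeg (GridPoint Lf N) => Y j = x),
        ‖kernel ℂ (W' - ∑ β', ExteriorAlgebra.map (Fe β') V) (2 * m') Y‖ * diamWeight phi d' (univ.image Y) ≤ ND m' := by
    intro m' j x
    rw [hdef]
    rcases Nat.lt_trichotomy m' 1 with hm | rfl | hm
    · have : m' = 0 := by omega
      subst this
      exact absurd j.2 (by omega)
    · -- degree 2: the weighted counterterm defect bound in the residue distance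
      have himg : ∀ Y : Fin (2 * 1) → GridLeg (GridPoint Lf N), univ.image Y = {Y 0, Y 1} := by
        intro Y; ext z
        simp only [mem_image, mem_univ, true_and, mem_insert, mem_singleton]
        constructor
        · rintro ⟨⟨k, hk⟩, rfl⟩
          rcases k with _ | _ | k
          · exact Or.inl rfl
          · exact Or.inr rfl
          · exact absurd hk (by omega)
        · rintro (rfl | rfl)
          exacts [⟨0, rfl⟩, ⟨1, rfl⟩]
      have h := sum_wt_norm_kernel_counterGlueDefect_le e he2 Fe hFe hLf β K K'' j x
        (fun Y => diamWeight phi d' (univ.image Y)) (fun Y => zero_le_one.trans (hphi1 _ (labelDiam_nonneg _ _)))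
        (D := R) (Φ := 1 + (R : ℝ)) (by positivity) hRK.le hRK''.le (fun Y hY => by
          rw [himg Y, hpairw]
          simp only [add_le_add_iff_left]
          exact_mod_cast hY)
      exact h.trans hND
    · -- degrees ≥ 4: the input defect has no such kernels
      have h0 : ∀ Y : Fin (2 * m') → GridLeg (GridPoint Lf N),
          kernel ℂ (hubbardGridCounterQuadratic Lf N β K'' - ∑ β', ExteriorAlgebra.map (Fe β') (hubbardGridCounterQuadratic L N β K)) (2 * m') Y = 0 :=
        fun Y => kernel_counterGlueDefect_of_ne e Fe hFe β K K'' (by omega) Y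
      simp only [h0, norm_zero, zero_mul, sum_const_zero]
      exact hND0 m'
  -- input defect: plain profile at deep pins = the frame mismatch only
  have hEp : ∀ m' (j : Fin (2 * m')) (x : GridLeg (GridPoint Lf N)), (∀ k, R ≤ (x.1.1.2 k).val % L ∧ (x.1.1.2 k).val % L + R < L) →
      ∑ Y ∈ univ.filter (fun Y : Fin (2 * m') → GridLeg (GridPoint Lf N) => Y j = x),
        ‖kernel ℂ (W' - ∑ β', ExteriorAlgebra.map (Fe β') V) (2 * m') Y‖ ≤ E m' := by
    intro m' j x hx
    rw [hdef]
    rcases Nat.lt_trichotomy m' 1 with hm | rfl | hm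
    · have : m' = 0 := by omega
      subst this
      exact absurd j.2 (by omega)
    · exact (sum_norm_kernel_counterGlueDefect_le_of_deep e he1 he2 Fe hFe hLf β K K'' hRK j x hx).trans hE
    · have h0 : ∀ Y : Fin (2 * m') → GridLeg (GridPoint Lf N),
          kernel ℂ (hubbardGridCounterQuadratic Lf N β K'' - ∑ β', ExteriorAlgebra.map (Fe β') (hubbardGridCounterQuadratic L N β K)) (2 * m') Y = 0 :=
        fun Y => kernel_counterGlueDefect_of_ne e Fe hFe β K K'' (by omega) Y
      simp only [h0, norm_zero, sum_const_zero]
      exact hE0 m'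
  -- assemble the generic STEP
  have hmain := sum_norm_kernel_twoVolume_step_le_linear e CL CLf Ccop Dn Df Zs hCcop hDf hDn hP
    (fun X' Y' => R < Torus.tnorm (X'.1.1.2 - Y'.1.1.2)) hG1 hG2 hT0 hT
    (norm_near_le_of_sectional e he2 CL CLf Ccop Dn Zs hCcop hDn hP R hG1 hG2 hsec) hCt hC't hs0 hs'0 hs hs' hαα hrow hrow'
    dc hdc hm0 hm0' hm1 hm1''
    (add_pos hκ' hκ) hGBf (add_pos (add_pos hκ' hκ) (add_pos (add_pos hκ' hκ) (add_pos hκ' hκ))) hGB2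
    (by positivity : (0 : ℝ) < (R' : ℝ) + 1) w hdR Fe hFe hVe hV0 hZ Nw hNw0 hNw hρf hθw hρ₂ hθ₂
    hκ' hGB' d' hd' hphi1 hphimono hphisub W' hW'e hW'0 NV ND E hNV0 hND0 hE0 ?iNV ?iND
    (fun x : GridLeg (GridPoint Lf N) => ∀ k, R ≤ (x.1.1.2 k).val % L ∧ (x.1.1.2 k).val % L + R < L) ?iE
    hαw ?iroww ?icolw hρ' hνE hbar hθ₂' (by positivity : (0 : ℝ) ≤ (R' : ℝ) + 1) hwd n p
  -- (the five Γ′-side profile data are re-read in the STEP's `LinearOrder`-derived decidability instances)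
  case iroww => intro X'; convert hroww' X' using 6
  case icolw => intro Y'; convert hcolw' Y' using 6
  case iNV => intro m' j x; convert hNVp m' j x using 6
  case iND => intro m' j x; convert hNDp m' j x using 6
  case iE => intro m' j x hx; convert hEp m' j x hx using 6
  convert hmain using 3

end Summit.HubbardSuperconductivity.HubbardSuperconductivity.Theorems.TwoVolumeDefect

end
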